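import Mathlib.AlgebraicGeometry.Morphisms.FiniteType
import Mathlib.AlgebraicGeometry.Morphisms.QuasiCompact
import Mathlib.RingTheory.WittVector.DiscreteValuationRing
import Literature.AlgebraicGeometry.Motives.CrystallineRealization
import HarnessLib

/-!
# Greenberg's strong approximation theorem (1966) over the Witt vectors `W(k)`

M. J. Greenberg, *Rational points in Henselian discrete valuation rings*, Publ. Math. IHÉS 31
(1966) 59–64, proves (p. 59, verbatim):

* **Theorem 1.** "Let `R` be a Henselian discrete valuation ring, with `t` a generator of the
  maximal ideal, `k` the residue field, and `K` the field of fractions. Let `R*` be the completion of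
  `R`, `K*` its field of fractions. […] Assume, in case `K` has characteristic `p > 0`, that `K*` is
  separable over `K`. Then there are integers `N ≥ 1, c ≥ 1, s ≥ 0` depending on `F R[X]` such that
  for any `ν ≥ N` and any `x` in `R` such that `F(x) ≡ 0 (mod t^ν)` there exists `y` in `R` such that
  `y ≡ x (mod t^{[ν/c]−s})`, `F(y) = 0`."
* **Corollary 1.** "Let `Z` be a prescheme of finite type over `R`. Then there are integers
  `N ≥ 1, c ≥ 1, s ≥ 0` depending on `Z` such that for `ν ≥ N` and for any point `x` of `Z` in
  `R/t^ν`, the image of `x` in `Z(R/t^{[ν/c]−s})` lifts to a point of `Z` in `R`." (Proof printed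
  there: a finite affine open cover reduces to Theorem 1, since `Z(S) = ⋃ Z_i(S)` for local `S`.)
* **Corollary 2.** "`Z` has a point in `R` if and only if `Z` has a point in `R/t^ν` for all
  `ν ≥ 1`."

This file vendors Corollary 1 as ONE named fact (D-0014: `def … : Prop`, nothing asserted), in
the SPECIAL CASE the tree consumes (route `HodgeConjecture/DiscRigidSeeds`, crux item
`stmt-HodgeConjecture-27011` `GreenbergLiftingDeterminacy`, skeleton stub `stub_greenberg`):
`R = W(k)` the ring of `p`-typical Witt vectors of a perfect field `k` of characteristic `p`, `t = p`.
`W(k)` is a complete discrete valuation ring with maximal ideal `(p)` and fraction field of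
characteristic `0` (Serre, *Corps locaux* II §5–§6; Mathlib `WittVector.isDiscreteValuationRing`,
`WittVector.irreducible`), hence Henselian, and Greenberg's separability proviso (only in equal
characteristic `p`) is vacuous; "prescheme of finite type" (1966) = scheme locally of finite type and
quasi-compact over `Spec R` (no separatedness), which is how the hypotheses are typed. Points of `Z`
"in `R/t^ν`" resp. "in `R`" are `R`-morphisms `Spec (R/t^ν) → Z` resp. sections of `Z → Spec R`;
they are written with the tree's `wittQuot p k ν = W(k) ⧸ (p)^ν`
(`Literature.AlgebraicGeometry.Motives.CrystallineRealization`) and Mathlib's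
`Ideal.Quotient.factor` for `W/p^ν → W/p^m`, exactly as in
`Literature.AlgebraicGeometry.Motives.WittScheme.quotSpec` / `quotTransition`.

Proved here (no further facts): Corollary 2 in the form the consumer's stub has — a finite-type
`W(k)`-scheme with a `W(k)/p^{n+1}`-point for every `n` has a `W(k)`-point
(`Greenberg1966_strongApproximation.exists_section_of_forall_exists_sectionMod`) — and its trivial
converse (`exists_sectionMod_of_exists_section`). The truncated subtraction `ν / c - s : ℕ` is
Greenberg's `[ν/c] − s` when that is `≥ 0` and `0` otherwise; a congruence "mod `p^0`" is vacuous
(`W/p^0 = 0`, `Spec 0 = ∅`), so the fact is not strengthened by the junk value.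

Deliberately NOT here: the general Henselian (excellent) d.v.r. `R` and general `t` (Mathlib has no
bundled "complete d.v.r. with uniformizer" interface matching the consumer; see the TODO), the value
`c = 1` in the smooth case (Néron), constructibility consequences, Artin approximation.

## References
* [Greenberg1966] M. J. Greenberg, Publ. Math. IHÉS 31 (1966) 59–64, Thm 1, Cor 1, Cor 2 (p. 59),
  doi:10.1007/bf02684802.
-/

noncomputable section

open CategoryTheory AlgebraicGeometry

universe u

namespace Literature.AlgebraicGeometry.Deformation

open Literature.AlgebraicGeometry.Motives

/-- **Greenberg 1966, Theorem 1 / Corollary 1 (strong approximation), for `R = W(k)`.**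
Printed statement (Publ. Math. IHÉS 31, p. 59, Corollary 1): "Let `Z` be a prescheme of finite type
over `R` [a Henselian discrete valuation ring with uniformizer `t`; in equal characteristic `p` assume
`Frac(R*)` separable over `Frac(R)`]. Then there are integers `N ≥ 1, c ≥ 1, s ≥ 0` depending on `Z`
such that for `ν ≥ N` and for any point `x` of `Z` in `R/t^ν`, the image of `x` in
`Z(R/t^{[ν/c]−s})` lifts to a point of `Z` in `R`."
Here: `R = W(k)` (`k` a perfect field of characteristic `p`; a complete d.v.r. with `t = p` and
fraction field of characteristic `0`, so every proviso holds), `Z` a `W(k)`-scheme locally of finite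
type and quasi-compact; a "point in `R/t^ν`" is a `W(k)`-morphism `Spec (W(k)/p^ν) → Z`, a "point in
`R`" is a section `y` of `Z → Spec W(k)`, and "`y` lifts the image of `x` in `Z(R/t^m)`",
`m = [ν/c] − s`, is the equality of the two composites `Spec (W/p^m) → Spec W → Z` and
`Spec (W/p^m) → Spec (W/p^ν) → Z`. Named fact; nothing asserted; no `_holds`.
-- TODO(general form): any Henselian d.v.r. `R` with `Frac(R̂)/Frac(R)` separable, any uniformizer
-- `t`, `Z` of finite type over `R` (Greenberg's Theorem 1 / Corollary 1 verbatim); `c = 1` for `Z`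
-- smooth over `R` (Néron, cited loc. cit. p. 59).
[cite: Greenberg1966, Thm 1 and Cor 1 (p. 59)] -/
def Greenberg1966_strongApproximation : Prop :=
  ∀ (p : ℕ) [Fact p.Prime] (k : Type u) [Field k] [CharP k p] [PerfectRing k p]
    (Z : SchemeOver (WittVector p k)),
    LocallyOfFiniteType Z.hom → QuasiCompact Z.hom →
    ∃ N c s : ℕ, 1 ≤ N ∧ 1 ≤ c ∧
      ∀ ν : ℕ, N ≤ ν →
        ∀ x : Spec (.of (wittQuot p k ν)) ⟶ Z.left,
          x ≫ Z.hom =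
              Spec.map (CommRingCat.ofHom (algebraMap (WittVector p k) (wittQuot p k ν))) →
          ∃ y : Spec (.of (WittVector p k)) ⟶ Z.left,
            y ≫ Z.hom = 𝟙 _ ∧
              Spec.map (CommRingCat.ofHom
                  (algebraMap (WittVector p k) (wittQuot p k (ν / c - s)))) ≫ y =
                Spec.map (CommRingCat.ofHom (Ideal.Quotient.factor
                  (Ideal.pow_le_pow_right
                    (le_trans (Nat.sub_le (ν / c) s) (Nat.div_le_self ν c))))) ≫ x

/-- **Greenberg 1966, Corollary 2 (p. 59), the non-trivial direction, for `R = W(k)`** — derived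
from `Greenberg1966_strongApproximation`: "`Z` has a point in `R` if […] `Z` has a point in `R/t^ν`
for all `ν ≥ 1`." In the tree's vocabulary: if a `W(k)`-scheme `Z`, locally of finite type and
quasi-compact, has a `W(k)/p^{n+1}`-valued point over `W(k)` for every `n : ℕ`, then `Z → Spec W(k)`
has a section. This is exactly the shape of the consumer stub `stub_greenberg` of
`Summit.HodgeConjecture.HodgeConjecture.Theses.DiscRigidSeeds.GreenbergLiftingDeterminacy`
(its `HasSectionMod p k n Z` / `HasSection p k Z` unfolded). Proof: take `ν = N` in Corollary 1.
[cite: Greenberg1966, Cor 2 (p. 59)] -/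
theorem Greenberg1966_strongApproximation.exists_section_of_forall_exists_sectionMod
    (h : Greenberg1966_strongApproximation.{u})
    (p : ℕ) [Fact p.Prime] (k : Type u) [Field k] [CharP k p] [PerfectRing k p]
    (Z : SchemeOver (WittVector p k)) (hft : LocallyOfFiniteType Z.hom) (hqc : QuasiCompact Z.hom)
    (hx : ∀ n : ℕ, ∃ x : Spec (.of (wittQuot p k (n + 1))) ⟶ Z.left,
      x ≫ Z.hom =
        Spec.map (CommRingCat.ofHom (algebraMap (WittVector p k) (wittQuot p k (n + 1))))) :
    ∃ y : Spec (.of (WittVector p k)) ⟶ Z.left, y ≫ Z.hom = 𝟙 _ := by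
  obtain ⟨N, c, s, hN, -, H⟩ := h p k Z hft hqc
  obtain ⟨x, hx'⟩ := hx (N - 1)
  obtain ⟨y, hy, -⟩ := H (N - 1 + 1) (by omega) x hx'
  exact ⟨y, hy⟩

/-- **Greenberg 1966, Corollary 2 (p. 59), the trivial direction**: a `W(k)`-point of `Z` reduces to
a `W(k)/p^n`-point over `W(k)` for every `n` (compose the section with `Spec (W/p^n) → Spec W`).
[cite: Greenberg1966, Cor 2 (p. 59)] -/
theorem exists_sectionMod_of_exists_section
    (p : ℕ) [Fact p.Prime] (k : Type u) [CommRing k] (Z : SchemeOver (WittVector p k))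
    (hy : ∃ y : Spec (.of (WittVector p k)) ⟶ Z.left, y ≫ Z.hom = 𝟙 _) (n : ℕ) :
    ∃ x : Spec (.of (wittQuot p k n)) ⟶ Z.left,
      x ≫ Z.hom = Spec.map (CommRingCat.ofHom (algebraMap (WittVector p k) (wittQuot p k n))) := by
  obtain ⟨y, hy⟩ := hy
  refine ⟨Spec.map (CommRingCat.ofHom (algebraMap (WittVector p k) (wittQuot p k n))) ≫ y, ?_⟩
  rw [Category.assoc, hy, Category.comp_id]

end Literature.AlgebraicGeometry.Deformation

end
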